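import Summits.Ventures.LatticeQCDFlow.Exactness.FlowSamplerOddObservableExact
import HarnessLib

/-!
# SYMMETRISING A FLOW IS FREE: the `σ`-symmetrised model `q̃ₛ = ½(q̃ + q̃∘σ)` never rejects more, never has a larger importance-weight moment, never has a larger sticking column — and is exact on odd observables

HONEST FRAMING: exact (Metropolis-corrected) sampling algorithms for lattice gauge theory;
figures of merit are autocorrelation/cost numbers at stated couplings and volumes; no
continuum-physics claim.  (SCALAR calibration rung S0-A: not a gauge result.)

Venture `LatticeQCDFlow` (cell pub-lqcd), topic `Exactness`; FANOUT row 2 (`s0-phi4`, FLOW arm: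
independence Metropolis `K = imhOp μ w q̃`).  NEW WORK of the cell.  Setting: an s-finite measure
space `(X, μ)`, a MEASURE-PRESERVING INVOLUTION `σ` (`σ ∘ σ = id`; lattice φ⁴: `φ ↦ −φ` on `ℝ^Λ`), an
EVEN target weight `w ∘ σ = w` (the φ⁴ action is even), and an ARBITRARY positive normalised model
density `q̃` — no symmetry asked of the network.  The symmetrised proposal "draw `φ' ∼ q̃`, then apply
`σ` with probability ½" has density `q̃ₛ = ½(q̃ + q̃ ∘ σ)`.  Per Metropolis step (one extra density
evaluation `q̃(σφ')`), elementary convexity gives, with `r_q(x)` the rejection probability from `x`: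

* `symmetrised_facts` — `q̃ₛ > 0`, measurable, integrable, `∫ q̃ₛ = 1`, `q̃ₛ ∘ σ = q̃ₛ`;
* **`symmetrised_rejection_le`** — POINTWISE `r_{q̃ₛ}(x) ≤ ½(r_q̃(x) + r_q̃(σx))`
  (`min(a + b, c + d) ≥ min(a, c) + min(b, d)` on the accepted-proposal density, then `z ↦ σz`);
* **`symmetrised_meanRejection_le`** — `∫ r_{q̃ₛ} w ≤ ∫ r_q̃ w`: the mean acceptance never drops;
* **`symmetrised_weightMoment_le`** — `∫ w²/q̃ₛ ≤ ∫ w²/q̃` (AM–HM): the importance-sampling effective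
  sample size `Z²/W₂` never drops;
* **`symmetrised_stickingColumn_le`** — for every `g` with `g² ∘ σ = g²` (odd OR even observables):
  `∫ g² w r_{q̃ₛ}/(1 − r_{q̃ₛ}) ≤ ∫ g² w r_q̃/(1 − r_q̃)` (`t ↦ t/(1 − t)` is increasing and midpoint-convex
  on `[0,1)`), integrability included;
* **`symmetrised_tauInt_eq_of_odd`** — for ODD `g` (`g ∘ σ = −g`) with `∫ g² w r_q̃/(1 − r_q̃) < ∞`: under
  the symmetrised sampler the normalised autocorrelation series of `g` is summable and
  `τ_int^{q̃ₛ}(g) = ½ + S_g(q̃ₛ) ≤ ½ + S_g(q̃)` EXACTLY-then-bounded (`FlowSamplerOddObservableExact`),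
  `S_g(·) = E_{g²w}[r/(1 − r)]`; since `½ + S_g(q̃) ≤ τ_int^{q̃}(g)` whenever the original series is
  summable (`Phi4FlowSquareIntegrableSticking`), symmetrising never increases `τ_int` of an odd
  observable — the lattice statement for the magnetisation is drawn in the lattice file.

NOT CLAIMED: that the symmetrised sampler is cheaper per unit cost (it evaluates the model density
twice per proposal); anything for observables with `g² ∘ σ ≠ g²`; any value of `r`, `W₂`, `S` for any
network; anything for the HMC / local arms.  Liu 1996 (Metropolized independence sampling) and the
Rao–Blackwell / symmetrisation folklore NAMED, nothing cited as a fact.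
-/

namespace Summit.Ventures.LatticeQCDFlow.Exactness

open Real MeasureTheory Filter Finset Set Topology
open Summit.Ventures.LatticeQCDFlow.Scoring

/-! ## §0 Three scalar inequalities -/

/-- `min a c + min b d ≤ min (a + b) (c + d)`. -/
theorem min_add_min_le_min_add (a b c d : ℝ) : min a c + min b d ≤ min (a + b) (c + d) :=
  le_min (add_le_add (min_le_left _ _) (min_le_left _ _))
    (add_le_add (min_le_right _ _) (min_le_right _ _))

/-- AM–HM for two positive reals: `1/((a + b)/2) ≤ (1/a + 1/b)/2`. -/
theorem one_div_midpoint_le {a b : ℝ} (ha : 0 < a) (hb : 0 < b) :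
    1 / ((a + b) / 2) ≤ (1 / a + 1 / b) / 2 := by
  rw [div_le_div_iff₀ (by positivity) two_pos, div_add_div _ _ ha.ne' hb.ne',
    div_mul_eq_mul_div, le_div_iff₀ (mul_pos ha hb)]
  nlinarith [sq_nonneg (a - b), mul_pos ha hb]

/-- The odds map `t ↦ t/(1 − t)` is increasing and midpoint-convex on `(−∞,1)`: `m ≤ (a + b)/2`,
`a, b < 1` ⇒ `m/(1 − m) ≤ (a/(1 − a) + b/(1 − b))/2`. -/
theorem odds_le_midpoint {a b m : ℝ} (ha : a < 1) (hb : b < 1) (hm : m ≤ (a + b) / 2) :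
    m / (1 - m) ≤ (a / (1 - a) + b / (1 - b)) / 2 := by
  have hm1 : m < 1 := by linarith
  have e : ∀ t : ℝ, t < 1 → t / (1 - t) = 1 / (1 - t) - 1 := fun t ht => by
    have h : (1 - t) ≠ 0 := by linarith
    field_simp
    ring
  rw [e m hm1, e a ha, e b hb]
  have h1 : 1 / (1 - m) ≤ 1 / (1 - (a + b) / 2) :=
    one_div_le_one_div_of_le (by linarith) (by linarith)
  have h2 : 1 / (1 - (a + b) / 2) ≤ (1 / (1 - a) + 1 / (1 - b)) / 2 := by
    have h := one_div_midpoint_le (a := 1 - a) (b := 1 - b) (by linarith) (by linarith)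
    have e' : ((1 - a) + (1 - b)) / 2 = 1 - (a + b) / 2 := by ring
    rwa [e'] at h
  linarith

/-! ## §1 A measure-preserving involution -/

section General

variable {X : Type*} [MeasurableSpace X] {μ : Measure X} [SFinite μ] {w q : X → ℝ} {σ : X → X}

omit [SFinite μ] in
/-- An involutive measure-preserving map is a measurable embedding, so `∫ F ∘ σ = ∫ F` for every `F`. -/
theorem integral_comp_involution (hσ : MeasurePreserving σ μ μ) (hσσ : ∀ x, σ (σ x) = x)
    (F : X → ℝ) : ∫ x, F (σ x) ∂μ = ∫ x, F x ∂μ :=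
  hσ.integral_comp (⟨⟨σ, σ, hσσ, hσσ⟩, hσ.measurable, hσ.measurable⟩ : X ≃ᵐ X).measurableEmbedding F

omit [SFinite μ] in
/-- … and `F ∘ σ ∈ L¹` whenever `F ∈ L¹`. -/
theorem integrable_comp_involution (hσ : MeasurePreserving σ μ μ) (hσσ : ∀ x, σ (σ x) = x)
    {F : X → ℝ} (hF : Integrable F μ) : Integrable (fun x => F (σ x)) μ :=
  (hσ.integrable_comp_emb
    (⟨⟨σ, σ, hσσ, hσσ⟩, hσ.measurable, hσ.measurable⟩ : X ≃ᵐ X).measurableEmbedding).2 hF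

/-! ## §2 The symmetrised model density -/

omit [SFinite μ] in
/-- **`q̃ₛ = ½(q̃ + q̃ ∘ σ)` is a positive, measurable, normalised, `σ`-symmetric model density.** -/
theorem symmetrised_facts (hσ : MeasurePreserving σ μ μ) (hσσ : ∀ x, σ (σ x) = x)
    (hq0 : ∀ t, 0 < q t) (hqm : Measurable q) (hqi : Integrable q μ) (hq1 : ∫ z, q z ∂μ = 1) :
    (∀ t, 0 < (q t + q (σ t)) / 2) ∧ Measurable (fun t => (q t + q (σ t)) / 2) ∧
    Integrable (fun t => (q t + q (σ t)) / 2) μ ∧ (∫ t, (q t + q (σ t)) / 2 ∂μ = 1) ∧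
    (∀ t, (q (σ t) + q (σ (σ t))) / 2 = (q t + q (σ t)) / 2) := by
  have hqσ := integrable_comp_involution hσ hσσ hqi
  refine ⟨fun t => div_pos (add_pos (hq0 t) (hq0 _)) two_pos,
    (hqm.add (hqm.comp hσ.measurable)).div_const 2, (hqi.add hqσ).div_const 2, ?_,
    fun t => by rw [hσσ, add_comm]⟩
  rw [integral_div, integral_add hqi hqσ, integral_comp_involution hσ hσσ q, hq1]
  norm_num

/-! ## §3 Acceptance: pointwise and on average -/

omit [MeasurableSpace X] in
/-- The accepted-proposal density from `x`: `α_q(x,z) q(z) = min(q(z), w(z) q(x)/w(x))`. -/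
theorem imhAcceptQ_mul_eq_min (hw0 : ∀ t, 0 < w t) (hq0 : ∀ t, 0 < q t) (x z : X) :
    imhAcceptQ w q x z * q z = min (q z) (w z * q x / w x) := by
  unfold imhAcceptQ
  rw [min_mul_of_nonneg _ _ (hq0 z).le, one_mul]
  congr 1
  have hw := (hw0 x).ne'
  have hq := (hq0 z).ne'
  field_simp

omit [SFinite μ] in
/-- `z ↦ min(q z, w z c)` is integrable for `c ≥ 0` (it lies in `[0, q]`). -/
theorem integrable_min_density (hw0 : ∀ t, 0 < w t) (hwm : Measurable w) (hq0 : ∀ t, 0 < q t)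
    (hqm : Measurable q) (hqi : Integrable q μ) {c : ℝ} (hc : 0 ≤ c) :
    Integrable (fun z => min (q z) (w z * c)) μ := by
  refine Integrable.mono' hqi (hqm.min (hwm.mul_const c)).aestronglyMeasurable
    (Eventually.of_forall fun z => ?_)
  rw [Real.norm_eq_abs, abs_of_nonneg (le_min (hq0 z).le (mul_nonneg (hw0 z).le hc))]
  exact min_le_left _ _

omit [SFinite μ] in
/-- The rejection probability as one minus the accepted mass: `r_q(x) = 1 − ∫ min(q, w q(x)/w(x))`. -/
theorem rejection_eq_one_sub (hw0 : ∀ t, 0 < w t) (hwm : Measurable w) (hq0 : ∀ t, 0 < q t)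
    (hqm : Measurable q) (hqi : Integrable q μ) (hq1 : ∫ z, q z ∂μ = 1) (x : X) :
    ∫ z, (1 - imhAcceptQ w q x z) * q z ∂μ = 1 - ∫ z, min (q z) (w z * (q x / w x)) ∂μ := by
  have hc : 0 ≤ q x / w x := (div_pos (hq0 x) (hw0 x)).le
  have e : ∀ z, (1 - imhAcceptQ w q x z) * q z = q z - min (q z) (w z * (q x / w x)) := fun z => by
    rw [sub_mul, one_mul, imhAcceptQ_mul_eq_min hw0 hq0, mul_div_assoc]
  simp_rw [e]
  rw [integral_sub hqi (integrable_min_density hw0 hwm hq0 hqm hqi hc), hq1]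

omit [SFinite μ] in
/-- **SYMMETRISING NEVER REJECTS MORE, POINTWISE**: for every current state `x`,
`r_{q̃ₛ}(x) ≤ ½ (r_q̃(x) + r_q̃(σx))` — the accepted-proposal density of `q̃ₛ` from `x` dominates the
average of those of `q̃` from `x` and from `σx` (`min` is superadditive), and `∫ F ∘ σ = ∫ F`. -/
theorem symmetrised_rejection_le (hσ : MeasurePreserving σ μ μ) (hσσ : ∀ x, σ (σ x) = x)
    (hw0 : ∀ t, 0 < w t) (hwm : Measurable w) (hw : ∀ t, w (σ t) = w t) (hq0 : ∀ t, 0 < q t)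
    (hqm : Measurable q) (hqi : Integrable q μ) (hq1 : ∫ z, q z ∂μ = 1) (x : X) :
    ∫ z, (1 - imhAcceptQ w (fun t => (q t + q (σ t)) / 2) x z) * ((q z + q (σ z)) / 2) ∂μ
      ≤ ((∫ z, (1 - imhAcceptQ w q x z) * q z ∂μ)
          + ∫ z, (1 - imhAcceptQ w q (σ x) z) * q z ∂μ) / 2 := by
  obtain ⟨hs0, hsm, hsi, hs1, -⟩ := symmetrised_facts hσ hσσ hq0 hqm hqi hq1
  rw [rejection_eq_one_sub hw0 hwm hs0 hsm hsi hs1, rejection_eq_one_sub hw0 hwm hq0 hqm hqi hq1,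
    rejection_eq_one_sub hw0 hwm hq0 hqm hqi hq1]
  -- the accepted mass from `σ x` rewritten as an integral of a `σ`-shifted integrand
  have hcx : 0 ≤ q x / w x := (div_pos (hq0 x) (hw0 x)).le
  have hcσ : 0 ≤ q (σ x) / w x := (div_pos (hq0 _) (hw0 x)).le
  have hshift : ∫ z, min (q z) (w z * (q (σ x) / w (σ x))) ∂μ
      = ∫ z, min (q (σ z)) (w z * (q (σ x) / w x)) ∂μ := by
    rw [hw x, ← integral_comp_involution hσ hσσ (fun z => min (q z) (w z * (q (σ x) / w x)))]
    refine integral_congr_ae (Eventually.of_forall fun z => ?_)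
    show min (q (σ z)) (w (σ z) * (q (σ x) / w x)) = min (q (σ z)) (w z * (q (σ x) / w x))
    rw [hw z]
  rw [hshift]
  have hI1 := integrable_min_density hw0 hwm hq0 hqm hqi hcx
  have hI2 : Integrable (fun z => min (q (σ z)) (w z * (q (σ x) / w x))) μ := by
    refine Integrable.mono' (integrable_comp_involution hσ hσσ hqi)
      ((hqm.comp hσ.measurable).min (hwm.mul_const _)).aestronglyMeasurable
      (Eventually.of_forall fun z => ?_)
    rw [Real.norm_eq_abs, abs_of_nonneg (le_min (hq0 _).le (mul_nonneg (hw0 z).le hcσ))]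
    exact min_le_left _ _
  -- pointwise superadditivity of `min`
  have hpt : ∀ z, (min (q z) (w z * (q x / w x)) + min (q (σ z)) (w z * (q (σ x) / w x))) / 2
      ≤ min ((q z + q (σ z)) / 2) (w z * ((q x + q (σ x)) / 2 / w x)) := by
    intro z
    have h := min_add_min_le_min_add (q z) (q (σ z)) (w z * (q x / w x)) (w z * (q (σ x) / w x))
    have e2 : w z * ((q x + q (σ x)) / 2 / w x) = (w z * (q x / w x) + w z * (q (σ x) / w x)) / 2 := by
      ring
    rw [e2, min_div_div_right (by norm_num : (0:ℝ) ≤ 2)]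
    linarith
  have hle : (∫ z, min (q z) (w z * (q x / w x)) ∂μ + ∫ z, min (q (σ z)) (w z * (q (σ x) / w x)) ∂μ) / 2
      ≤ ∫ z, min ((q z + q (σ z)) / 2) (w z * ((q x + q (σ x)) / 2 / w x)) ∂μ := by
    rw [← integral_add hI1 hI2, ← integral_div]
    exact integral_mono ((hI1.add hI2).div_const 2)
      (integrable_min_density hw0 hwm hs0 hsm hsi (div_pos (hs0 x) (hw0 x)).le) hpt
  linarith

/-- **THE MEAN REJECTION RATE NEVER INCREASES** (`w ∘ σ = w`): `∫ r_{q̃ₛ} w ≤ ∫ r_q̃ w`, i.e. the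
acceptance rate `ā = 1 − ∫ r w/Z` of the symmetrised sampler is at least that of the original. -/
theorem symmetrised_meanRejection_le (hσ : MeasurePreserving σ μ μ) (hσσ : ∀ x, σ (σ x) = x)
    (hw0 : ∀ t, 0 < w t) (hwm : Measurable w) (hwi : Integrable w μ) (hw : ∀ t, w (σ t) = w t)
    (hq0 : ∀ t, 0 < q t) (hqm : Measurable q) (hqi : Integrable q μ) (hq1 : ∫ z, q z ∂μ = 1) :
    ∫ x, (∫ z, (1 - imhAcceptQ w (fun t => (q t + q (σ t)) / 2) x z) * ((q z + q (σ z)) / 2) ∂μ)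
        * w x ∂μ
      ≤ ∫ x, (∫ z, (1 - imhAcceptQ w q x z) * q z ∂μ) * w x ∂μ := by
  obtain ⟨hs0, hsm, hsi, hs1, -⟩ := symmetrised_facts hσ hσσ hq0 hqm hqi hq1
  obtain ⟨hr0, hr1, hrm⟩ := rejection_bounds (μ := μ) hw0 hwm hq0 hqm hqi hq1
  obtain ⟨hs0', hs1', hsm'⟩ := rejection_bounds (μ := μ) hw0 hwm hs0 hsm hsi hs1
  set r : X → ℝ := fun x => ∫ z, (1 - imhAcceptQ w q x z) * q z ∂μ with hr
  set rs : X → ℝ := fun x => ∫ z, (1 - imhAcceptQ w (fun t => (q t + q (σ t)) / 2) x z)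
    * ((q z + q (σ z)) / 2) ∂μ with hrs
  have hrw : Integrable (fun x => r x * w x) μ := by
    refine Integrable.mono' hwi (hrm.mul hwm).aestronglyMeasurable (Eventually.of_forall fun x => ?_)
    rw [Real.norm_eq_abs, abs_of_nonneg (mul_nonneg (hr0 x) (hw0 x).le)]
    exact mul_le_of_le_one_left (hw0 x).le (hr1 x)
  have hrsw : Integrable (fun x => rs x * w x) μ := by
    refine Integrable.mono' hwi (hsm'.mul hwm).aestronglyMeasurable (Eventually.of_forall fun x => ?_)
    rw [Real.norm_eq_abs, abs_of_nonneg (mul_nonneg (hs0' x) (hw0 x).le)]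
    exact mul_le_of_le_one_left (hw0 x).le (hs1' x)
  have hrσw : Integrable (fun x => r (σ x) * w x) μ := by
    have h := integrable_comp_involution hσ hσσ hrw
    exact h.congr (Eventually.of_forall fun x => by simp only [hw])
  have hσint : ∫ x, r (σ x) * w x ∂μ = ∫ x, r x * w x ∂μ := by
    rw [← integral_comp_involution hσ hσσ (fun x => r x * w x)]
    exact integral_congr_ae (Eventually.of_forall fun x => by simp only [hw])
  have hpt : ∀ x, rs x * w x ≤ (r x * w x + r (σ x) * w x) / 2 := fun x => by
    have h := symmetrised_rejection_le hσ hσσ hw0 hwm hw hq0 hqm hqi hq1 x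
    have e : r (σ x) = ∫ z, (1 - imhAcceptQ w q (σ x) z) * q z ∂μ := rfl
    nlinarith [hw0 x]
  calc ∫ x, rs x * w x ∂μ ≤ ∫ x, (r x * w x + r (σ x) * w x) / 2 ∂μ :=
        integral_mono hrsw ((hrw.add hrσw).div_const 2) hpt
    _ = ∫ x, r x * w x ∂μ := by
        rw [integral_div, integral_add hrw hrσw, hσint]
        ring

/-! ## §4 The importance-weight moment (effective sample size) -/

omit [SFinite μ] in
/-- **THE IMPORTANCE-WEIGHT SECOND MOMENT NEVER INCREASES**: `W₂(q̃) = ∫ (w/q̃) w < ∞` ⇒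
`W₂(q̃ₛ) ≤ W₂(q̃)` (and is finite) — pointwise `1/q̃ₛ ≤ ½(1/q̃ + 1/q̃∘σ)` (AM–HM), then `∫ F ∘ σ = ∫ F`;
so the i.i.d. effective sample size `Z²/W₂` of the symmetrised flow is at least that of the flow. -/
theorem symmetrised_weightMoment_le (hσ : MeasurePreserving σ μ μ) (hσσ : ∀ x, σ (σ x) = x)
    (hw0 : ∀ t, 0 < w t) (hwm : Measurable w) (hw : ∀ t, w (σ t) = w t) (hq0 : ∀ t, 0 < q t)
    (hqm : Measurable q) (hW : Integrable (fun x => w x / q x * w x) μ) :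
    Integrable (fun x => w x / ((q x + q (σ x)) / 2) * w x) μ ∧
    ∫ x, w x / ((q x + q (σ x)) / 2) * w x ∂μ ≤ ∫ x, w x / q x * w x ∂μ := by
  have hWσ : Integrable (fun x => w x / q (σ x) * w x) μ := by
    have h := integrable_comp_involution hσ hσσ hW
    exact h.congr (Eventually.of_forall fun x => by simp only [hw])
  have hσint : ∫ x, w x / q (σ x) * w x ∂μ = ∫ x, w x / q x * w x ∂μ := by
    rw [← integral_comp_involution hσ hσσ (fun x => w x / q x * w x)]
    exact integral_congr_ae (Eventually.of_forall fun x => by simp only [hw])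
  have hnn : ∀ x, 0 ≤ w x / ((q x + q (σ x)) / 2) * w x := fun x =>
    mul_nonneg (div_nonneg (hw0 x).le (div_pos (add_pos (hq0 x) (hq0 _)) two_pos).le) (hw0 x).le
  have hpt : ∀ x, w x / ((q x + q (σ x)) / 2) * w x ≤ (w x / q x * w x + w x / q (σ x) * w x) / 2 := by
    intro x
    have h := one_div_midpoint_le (hq0 x) (hq0 (σ x))
    have hw2 : 0 ≤ w x * w x := mul_nonneg (hw0 x).le (hw0 x).le
    have e1 : w x / ((q x + q (σ x)) / 2) * w x = (1 / ((q x + q (σ x)) / 2)) * (w x * w x) := by ring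
    have e2 : (w x / q x * w x + w x / q (σ x) * w x) / 2 = ((1 / q x + 1 / q (σ x)) / 2) * (w x * w x) := by
      ring
    rw [e1, e2]
    exact mul_le_mul_of_nonneg_right h hw2
  have hint : Integrable (fun x => w x / ((q x + q (σ x)) / 2) * w x) μ := by
    refine Integrable.mono' ((hW.add hWσ).div_const 2)
      ((hwm.div ((hqm.add (hqm.comp hσ.measurable)).div_const 2)).mul hwm).aestronglyMeasurable
      (Eventually.of_forall fun x => ?_)
    rw [Real.norm_eq_abs, abs_of_nonneg (hnn x)]
    exact hpt x
  refine ⟨hint, ?_⟩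
  calc ∫ x, w x / ((q x + q (σ x)) / 2) * w x ∂μ
      ≤ ∫ x, (w x / q x * w x + w x / q (σ x) * w x) / 2 ∂μ :=
        integral_mono hint ((hW.add hWσ).div_const 2) hpt
    _ = ∫ x, w x / q x * w x ∂μ := by
        rw [integral_div, integral_add hW hWσ, hσint]
        ring

/-! ## §5 The sticking column -/

/-- **THE STICKING COLUMN NEVER INCREASES** for every observable with `g² ∘ σ = g²` (odd or even `g`):
`∫ g² w r_q̃/(1 − r_q̃) < ∞` ⇒ `g² w r_{q̃ₛ}/(1 − r_{q̃ₛ}) ∈ L¹` and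
`∫ g² w r_{q̃ₛ}/(1 − r_{q̃ₛ}) ≤ ∫ g² w r_q̃/(1 − r_q̃)` (pointwise `r_{q̃ₛ} ≤ ½(r_q̃ + r_q̃∘σ)`, the odds
map increasing and midpoint-convex on `[0,1)`, every `r < 1`, then `∫ F ∘ σ = ∫ F`). -/
theorem symmetrised_stickingColumn_le (hσ : MeasurePreserving σ μ μ) (hσσ : ∀ x, σ (σ x) = x)
    (hw0 : ∀ t, 0 < w t) (hwm : Measurable w) (hw : ∀ t, w (σ t) = w t) (hq0 : ∀ t, 0 < q t)
    (hqm : Measurable q) (hqi : Integrable q μ) (hq1 : ∫ z, q z ∂μ = 1) {g : X → ℝ}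
    (hgm : Measurable g) (hg : ∀ t, g (σ t) ^ 2 = g t ^ 2)
    (hS : Integrable (fun x => g x ^ 2 * w x * ((∫ z, (1 - imhAcceptQ w q x z) * q z ∂μ)
      / (1 - ∫ z, (1 - imhAcceptQ w q x z) * q z ∂μ))) μ) :
    Integrable (fun x => g x ^ 2 * w x
        * ((∫ z, (1 - imhAcceptQ w (fun t => (q t + q (σ t)) / 2) x z) * ((q z + q (σ z)) / 2) ∂μ)
          / (1 - ∫ z, (1 - imhAcceptQ w (fun t => (q t + q (σ t)) / 2) x z)
              * ((q z + q (σ z)) / 2) ∂μ))) μ ∧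
    ∫ x, g x ^ 2 * w x
        * ((∫ z, (1 - imhAcceptQ w (fun t => (q t + q (σ t)) / 2) x z) * ((q z + q (σ z)) / 2) ∂μ)
          / (1 - ∫ z, (1 - imhAcceptQ w (fun t => (q t + q (σ t)) / 2) x z)
              * ((q z + q (σ z)) / 2) ∂μ)) ∂μ
      ≤ ∫ x, g x ^ 2 * w x * ((∫ z, (1 - imhAcceptQ w q x z) * q z ∂μ)
          / (1 - ∫ z, (1 - imhAcceptQ w q x z) * q z ∂μ)) ∂μ := by
  obtain ⟨hs0, hsm, hsi, hs1, -⟩ := symmetrised_facts hσ hσσ hq0 hqm hqi hq1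
  obtain ⟨hr0, -, hrm⟩ := rejection_bounds (μ := μ) hw0 hwm hq0 hqm hqi hq1
  obtain ⟨hs0', -, hsm'⟩ := rejection_bounds (μ := μ) hw0 hwm hs0 hsm hsi hs1
  set r : X → ℝ := fun x => ∫ z, (1 - imhAcceptQ w q x z) * q z ∂μ with hr
  set rs : X → ℝ := fun x => ∫ z, (1 - imhAcceptQ w (fun t => (q t + q (σ t)) / 2) x z)
    * ((q z + q (σ z)) / 2) ∂μ with hrs
  have hrlt : ∀ x, r x < 1 := fun x => by
    show (∫ z, (1 - imhAcceptQ w q x z) * q z ∂μ) < 1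
    rw [rejection_eq_rejCurve hw0 hq0 x]
    exact rejCurve_lt_one hw0 hwm hq0 hqm hqi hq1 (div_pos (hw0 x) (hq0 x))
  set A : X → ℝ := fun x => g x ^ 2 * w x * (r x / (1 - r x)) with hA
  have hAσ : Integrable (fun x => A (σ x)) μ := integrable_comp_involution hσ hσσ hS
  have hAσ_eq : ∀ x, A (σ x) = g x ^ 2 * w x * (r (σ x) / (1 - r (σ x))) := fun x => by
    show g (σ x) ^ 2 * w (σ x) * (r (σ x) / (1 - r (σ x))) = g x ^ 2 * w x * (r (σ x) / (1 - r (σ x)))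
    rw [hg x, hw x]
  have hσint : ∫ x, A (σ x) ∂μ = ∫ x, A x ∂μ := integral_comp_involution hσ hσσ A
  have hnn : ∀ x, 0 ≤ g x ^ 2 * w x * (rs x / (1 - rs x)) := fun x =>
    mul_nonneg (mul_nonneg (sq_nonneg _) (hw0 x).le) (div_nonneg (hs0' x) (sub_nonneg.2 (by
      show rs x ≤ 1
      exact (rejection_bounds (μ := μ) hw0 hwm hs0 hsm hsi hs1).2.1 x)))
  have hpt : ∀ x, g x ^ 2 * w x * (rs x / (1 - rs x)) ≤ (A x + A (σ x)) / 2 := fun x => by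
    rw [hAσ_eq x]
    have hodds := odds_le_midpoint (hrlt x) (hrlt (σ x))
      (symmetrised_rejection_le hσ hσσ hw0 hwm hw hq0 hqm hqi hq1 x)
    have e : (A x + g x ^ 2 * w x * (r (σ x) / (1 - r (σ x)))) / 2
        = g x ^ 2 * w x * ((r x / (1 - r x) + r (σ x) / (1 - r (σ x))) / 2) := by
      simp only [hA]
      ring
    rw [e]
    exact mul_le_mul_of_nonneg_left hodds (mul_nonneg (sq_nonneg _) (hw0 x).le)
  have hint : Integrable (fun x => g x ^ 2 * w x * (rs x / (1 - rs x))) μ := by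
    refine Integrable.mono' ((hS.add hAσ).div_const 2)
      (((hgm.pow_const 2).mul hwm).mul (hsm'.div (measurable_const.sub hsm'))).aestronglyMeasurable
      (Eventually.of_forall fun x => ?_)
    rw [Real.norm_eq_abs, abs_of_nonneg (hnn x)]
    exact hpt x
  refine ⟨hint, ?_⟩
  calc ∫ x, g x ^ 2 * w x * (rs x / (1 - rs x)) ∂μ ≤ ∫ x, (A x + A (σ x)) / 2 ∂μ :=
        integral_mono hint ((hS.add hAσ).div_const 2) hpt
    _ = ∫ x, A x ∂μ := by
        rw [integral_div, integral_add hS hAσ, hσint]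
        ring

/-! ## §6 Odd observables: exact and never slower -/

/-- **FOR AN ODD OBSERVABLE THE SYMMETRISED SAMPLER IS EXACT AND ITS STICKING COLUMN IS SMALLER.**
`g ∘ σ = −g`, `g` measurable, `∫ g² w < ∞`, `∫ g² w r_q̃/(1 − r_q̃) < ∞`.  Then under `imhOp μ w q̃ₛ` the
normalised autocorrelation series of `g` is summable,
`τ_int^{q̃ₛ}(g) = ½ + (∫ g² w r_{q̃ₛ}/(1 − r_{q̃ₛ}))/∫ g² w` EXACTLY (`FlowSamplerOddObservableExact`), and
this is `≤ ½ + (∫ g² w r_q̃/(1 − r_q̃))/∫ g² w` — which in turn floors `τ_int^{q̃}(g)` whenever the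
original series is summable (`Phi4FlowSquareIntegrableSticking.imhOp_tauInt_ge_stickingSummed_of_sq`). -/
theorem symmetrised_tauInt_eq_of_odd (hσ : MeasurePreserving σ μ μ) (hσσ : ∀ x, σ (σ x) = x)
    (hw0 : ∀ t, 0 < w t) (hwm : Measurable w) (hwi : Integrable w μ) (hw : ∀ t, w (σ t) = w t)
    (hq0 : ∀ t, 0 < q t) (hqm : Measurable q) (hqi : Integrable q μ) (hq1 : ∫ z, q z ∂μ = 1)
    {g : X → ℝ} (hgm : Measurable g) (hg2 : Integrable (fun t => g t ^ 2 * w t) μ)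
    (hg : ∀ t, g (σ t) = -g t)
    (hS : Integrable (fun x => g x ^ 2 * w x * ((∫ z, (1 - imhAcceptQ w q x z) * q z ∂μ)
      / (1 - ∫ z, (1 - imhAcceptQ w q x z) * q z ∂μ))) μ) :
    (Summable fun k => (∫ t, g t * ((imhOp μ w (fun t => (q t + q (σ t)) / 2))^[k + 1] g) t * w t ∂μ)
        / ∫ t, g t ^ 2 * w t ∂μ) ∧
    tauInt (fun k => (∫ t, g t * ((imhOp μ w (fun t => (q t + q (σ t)) / 2))^[k] g) t * w t ∂μ)
        / ∫ t, g t ^ 2 * w t ∂μ)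
      = 1 / 2 + (∫ x, g x ^ 2 * w x
          * ((∫ z, (1 - imhAcceptQ w (fun t => (q t + q (σ t)) / 2) x z) * ((q z + q (σ z)) / 2) ∂μ)
            / (1 - ∫ z, (1 - imhAcceptQ w (fun t => (q t + q (σ t)) / 2) x z)
                * ((q z + q (σ z)) / 2) ∂μ)) ∂μ) / ∫ t, g t ^ 2 * w t ∂μ ∧
    1 / 2 + (∫ x, g x ^ 2 * w x
          * ((∫ z, (1 - imhAcceptQ w (fun t => (q t + q (σ t)) / 2) x z) * ((q z + q (σ z)) / 2) ∂μ)
            / (1 - ∫ z, (1 - imhAcceptQ w (fun t => (q t + q (σ t)) / 2) x z)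
                * ((q z + q (σ z)) / 2) ∂μ)) ∂μ) / ∫ t, g t ^ 2 * w t ∂μ
      ≤ 1 / 2 + (∫ x, g x ^ 2 * w x * ((∫ z, (1 - imhAcceptQ w q x z) * q z ∂μ)
          / (1 - ∫ z, (1 - imhAcceptQ w q x z) * q z ∂μ)) ∂μ) / ∫ t, g t ^ 2 * w t ∂μ := by
  obtain ⟨hs0, hsm, hsi, hs1, hsym⟩ := symmetrised_facts hσ hσσ hq0 hqm hqi hq1
  have hg' : ∀ t, g (σ t) ^ 2 = g t ^ 2 := fun t => by rw [hg t, neg_sq]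
  obtain ⟨hSs, hle⟩ := symmetrised_stickingColumn_le hσ hσσ hw0 hwm hw hq0 hqm hqi hq1 hgm hg' hS
  obtain ⟨hsum, heq⟩ := imhOp_tauInt_eq_of_odd hw0 hwm hwi hs0 hsm hsi hs1
    (integral_comp_involution hσ hσσ) hw hsym hgm hg2 hg hSs
  have hP0 : 0 ≤ ∫ t, g t ^ 2 * w t ∂μ := integral_nonneg fun t => mul_nonneg (sq_nonneg _) (hw0 t).le
  have hdiv := div_le_div_of_nonneg_right hle hP0
  exact ⟨hsum, heq, by linarith⟩

end General

end Summit.Ventures.LatticeQCDFlow.Exactness
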